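import Literature.MathematicalPhysics.QuantumFieldTheory.Balaban1983to89.Node00.Record13LiveSelectorFamily
import Literature.MathematicalPhysics.QuantumFieldTheory.Balaban1983to89.Node00.Record13Chi

/-!
# NODE 00 — OP 5a (dag-lead g40 HANDS-3 H3.1, director-ym №478): THE ₁₃ LIVE RE-PIN `liveRepin₁₃` IN THE χ SLOT — `Stage13Params.liveRepin₁₃Chi θ χ` —
# with `Record13` §4c's rows and FILE 8 ∕ FILE 8b's row-P12 letters along the χ-histories; `…Ax` at `[Ax-3]`'s `chiβOfRecord₁₃Ax`
# (χ-generic editions of exactly the statement-level centred declarations of `Record13LiveSelector` + `Record13LiveSelectorFamily` in dag-n07-w3 g22's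
# kernel σ-closure of the K0 V23 door, `SIGMA-CLOSURE-K0-V23-Ax.g22.md` 4ca252f7ab47910a; NEW names only, no body of record touched)

Cell `pub-ymgap`, seat `pub-ymgap-node00-def-Y` (g34; Node00 custodian ∕ definer), count-neutral.  [I] = [Balaban1987RG1], [III] = [Balaban1988Convergent],
[IV] = [Balaban1989LargeFieldI].  σ-recipe of [Ax-3b] `Node00/Record13Chi` (RC-1 g36 ✓p797305 ∕ ✓p797939): every object that reads the (2.9) β-slot species reads it
through ONE argument `χ : ChiSlot F N`; at `χ := chiβOfRecord₁₃ θ` it IS the object of record (`rfl`, §R), at `χ := chiβOfRecord₁₃Ax θ` it is the RE-CENTRED one (§A).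

WHY (dag-n07-w3 g22 FINDING 1, dag-n11-d g44 (K), this seat's supply map 2026-08-31): node00-def-K0a's live re-pin `Stage13Params.liveRepin₁₃ θ := { θ with ppSel :=
ppSelLiveOfRecord F N θ.ν θ.τ9 (EOfRecord₁₃ F N θ) (wOfRecord₉ …) }` (`Record13LiveSelector` :39) READS THE CENTRE through the ₁₃ normalisations `EOfRecord₁₃ θ`
(which read `gOfRecord₁₃ θ`, which solve (0.20) with `betaOfRecord₁₃ θ`, which read `chiβOfRecord₁₃ θ`).  Hence every witness family built on it —
`theta13LiveOfNumerics{,Z}`, DEF-1's `theta13OfThm1CCM{,WZB}` — is a centred DEFINITION, and the K0 V23 door (`…K0V23Stub3RunwiseSuppliers.k0Body_of_seam_of_runwiseZB`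
over k0-s1-w1's `…GuardedZBLam`) cannot be re-targeted at the re-centred record `K0ᴬ` (stmt-QuantumFields-27238, route rev 33) by a token pass alone: the re-pin
itself must be re-issued in the χ slot.  THIS FILE is that bottom layer; `Record13NumericsOfThm1CCMZChi` ∕ `…CCMWZBChi` ∕ `Record13LettersOfThm1CCMWZBChi` (this seat,
INTENT 2026-08-31T01:33Z) and the live-selector sockets (`Record13Sep{,CoP}LiveSelector{,Z}`, seat node00-def-RR-2) stand on it.

WHAT THIS FILE DECLARES (χ-generic twins, statement for statement, proof for proof — the proofs of record are HISTORY-GENERIC underneath (`Record12LiveSelectorInt`,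
`Record12MeasurabilityAbsolute`, def-R's `provisosInt_towerRepOfRecord_of_sel_fixed_or_null`), so they elaborate verbatim at `(EOfRecord₁₃Chi θ χ, gOfRecord₁₃Chi θ χ p)`):
* §0 `Record13` §4c ALONG THE χ-HISTORIES — `Stage13Params.measChi₁₃_of_localBg_chi ∕ measω₁₃_… ∕ intPiece₁₃_… ∕ integrable_slotsTOfRecord₁₃_succ_… ∕
  rstep₁₃_of_localBg_of_sel_chi ∕ rstep₁₃_of_localBg_liveSel_chi` (the six statement-level centred §4c entries of `Record13` in the σ-closure; hosted here because
  the re-pin's row-P12 letters are their first consumers — [Ax-3b] `Record13Chi` is untouched).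
* §1 `Stage13Params.liveRepin₁₃Chi θ χ` + the `rfl` faces (`_toStage8Params ∕ _ppSel ∕ _ζ ∕ _Rz ∕ _Zt ∕ _A₁`, `gOfRecord₁₃Chi_liveRepin₁₃Chi`, `EOfRecord₁₃Chi_…`,
  `wOfRecord₉_…`, `chiβOfRecord₁₃{,Ax}_liveRepin₁₃Chi`), the selector-blind transports `Admissible ∕ ZtUnity ∕ HasResidualsOfRecord .liveRepin₁₃Chi`, row P12 at it
  (`slotsNondegenerate₁₃_liveRepin_iff_chi ∕ _of_int_chi ∕ _chi`), the row-P11 objects (`settingOfRecord₁₃Chi_ ∕ suppOfRecord₁₃Chi_ ∕ UbgOfRecord₁₃Chi_liveRepin₁₃Chi`,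
  `bg_liveRepin₁₃_iff_chi`) and `Provisos₁₃Chi` at the re-pin from (H-U) ∧ row P11 (`provisos₁₃_liveRepin₁₃_of_localBg_chi ∕ _of_bg_chi`).
* §2 FILE 8b's hypothesis-free row P12: `slotsNondegenerate₁₃_liveRepin_of_localBg_chi ∕ _of_hasResiduals_chi`.
* §R receipts at the record's own slot (`rfl` ∕ `Iff.rfl`): `liveRepin₁₃Chi_chiβ : θ.liveRepin₁₃Chi F N (chiβOfRecord₁₃ F N θ) = θ.liveRepin₁₃ F N`.
* §A the re-centred edition: `abbrev Stage13Params.liveRepin₁₃Ax θ := θ.liveRepin₁₃Chi F N (chiβOfRecord₁₃Ax F N θ)`, `chiβOfRecord₁₃Ax_liveRepin₁₃Ax` (`rfl`),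
  `slotsNondegenerate₁₃Ax_liveRepin₁₃Ax_of_hasResiduals`.

HONEST FRAMING.  Definitions of a re-pinned parameter in the χ slot + `rfl` views + re-instantiation BY NAME of landed history-generic lemmas; nothing of Bałaban's
asserted, ported or discharged; `Provisos₁₃Chi` at the re-pin is a HYPOTHESIS∕reduction exactly as at the record; no value of χ is pinned for anybody; the K0 BODY at
the re-centred witness, the V24 skeleton and any registration are the k0 ∕ n07-w3 lanes' and the plan's, NOT this file's; K0ᴬ 27238 ∕ K1ᴬ 27239 ∕ K3ᴬ 27247 OPEN
(K2ᴬ 27246 proved by name); COUNT 8∕27 · K 1∕4 of record UNMOVED; one finite 𝕋⁴ programme at fixed `ε = L^{-K}` — NOT continuum ∕ ℝ⁴ ∕ OS; the Yang–Mills mass gap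
(Clay) is NOT proved by any of this.  No `sorry`, no `axiom`, no `instance`, no `notation`; standard axioms only.
-/

noncomputable section

open MeasureTheory
open scoped BigOperators Matrix.Norms.L2Operator

namespace Literature.MathematicalPhysics.QuantumFieldTheory.Balaban1983to89.Node00

open T4Continuum AveragingRT T4FiniteEpsInhabited B14.Eq218Concrete B15RopTotal FlowStep FlowStepRuns DagBinding T4DatumAssembly

/-! ## §0. `Record13` §4c ALONG THE χ-HISTORIES: rows `measChi` ∕ `measω` ∕ `intPiece` ∕ `rstep` are theorems of (H-U) and the ζ-laws at ANY β-slot χ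
(K0c's and def-R's history-generic cores re-instantiated at `EOfRecord₁₃Chi θ χ` ∕ `gOfRecord₁₃Chi θ χ p`; `Record13` :576–:672 token for token) -/

section Rows4cChi

variable {F : T4Family} {N : ℕ} [NeZero N]

/-- **ROW `measChi` UNDER (H-U)** along the χ-histories (`Record13` :576 in the χ slot). [cite: Balaban1988Convergent, (2.17)–(2.18) p.257, (3.2) p.265 (bookkeeping)] -/
theorem Stage13Params.measChi₁₃_of_localBg_chi (θ : Stage13Params F N) (χ : ChiSlot F N) (hU : LocalBgMeasurable F N θ.ν) :
    ∀ (p : B12.RunParams) (k : ℕ), k < p.K → ∀ s' : SeqOfRecord F θ.ν θ.τ9.M (gOfRecord₁₃Chi F N θ χ p) p.K (k + 1),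
      Measurable (chiSeqOfRecord F N θ.ν θ.τ9.M (gOfRecord₁₃Chi F N θ χ p) p.K (k + 1) s') :=
  fun p k _ s' => measurable_chiSeqOfRecord_of_localBg hU θ.τ9.M _ p.K (k + 1) s'

/-- **ROW `measω` UNDER (H-U) ∧ (H-ζ)** along the χ-histories (`Record13` :582 in the χ slot). [cite: Balaban1988Convergent, (3.2)–(3.5) p.265, (3.16) p.268, (3.24)–(3.25) p.270 (bookkeeping)] -/
theorem Stage13Params.measω₁₃_of_localBg_chi (θ : Stage13Params F N) (χ : ChiSlot F N) (hU : LocalBgMeasurable F N θ.ν) (hζ : ZetaMeasurable F N θ.ζ) :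
    ∀ (p : B12.RunParams) (k : ℕ), k < p.K → ∀ (s : SeqOfRecord F θ.ν θ.τ9.M (gOfRecord₁₃Chi F N θ χ p) p.K k)
      (t : LbOfRecord F θ.ν p (gOfRecord₁₃Chi F N θ χ p) k),
      Measurable (fun z : GaugeField (F.P p.K) (k + 1) (SU N) × GaugeField (F.P p.K) k (SU N) =>
        ωOfRecord F N θ.ν θ.τ9.M p (gOfRecord₁₃Chi F N θ χ p) k θ.A₁ θ.ζ s t z.2 z.1) :=
  fun p k _ s t => measurable_ωOfRecord_of_localBg hU θ.τ9.M p _ k θ.A₁ hζ s t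

/-- **ROW `intPiece` UNDER (H-U) ∧ (H-ζ) ∧ THE ζ-SIZE LAW ∧ `0 ≤ ζ`, ANY SELECTOR** along the χ-histories (`Record13` :591 in the χ slot).
[cite: Balaban1988Convergent, (2.18) p.257, (3.24)–(3.25) p.270; Balaban1989LargeFieldI, (0.3)–(0.4) p.176 (bookkeeping)] -/
theorem Stage13Params.intPiece₁₃_of_localBg_chi (θ : Stage13Params F N) (χ : ChiSlot F N) (hU : LocalBgMeasurable F N θ.ν) (hζ : ZetaMeasurable F N θ.ζ)
    (hζa : IsZetaAbsLeOne F N θ.ν θ.τ9.M θ.ζ) (hζ0 : ∀ p g k s Pl Ql RS U V', 0 ≤ θ.ζ p g k s Pl Ql RS U V') :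
    ∀ (p : B12.RunParams) (k : ℕ), k < p.K → ∀ s : SeqOfRecord F θ.ν θ.τ9.M (gOfRecord₁₃Chi F N θ χ p) p.K k,
      Integrable (fun U => chiSeqOfRecord F N θ.ν θ.τ9.M (gOfRecord₁₃Chi F N θ χ p) p.K k s U *
        slotsOfRecord F N θ.ν θ.τ9 (EOfRecord₁₃Chi F N θ χ) (wOfRecord₉ F N θ.toStage9Params) θ.ppSel p
          (gOfRecord₁₃Chi F N θ χ p) k s U) (fieldMeasure (F.P p.K) k (SU N)) :=
  fun p k hk s => (piece_slotsOfRecord_measurable_integrable F N θ.ν θ.τ9 (EOfRecord₁₃Chi F N θ χ) θ.ppSel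
    (fun j _ s' => measurable_wOfRecord_of_localBg hU θ.τ9.M θ.A₁ hζ p _ j s')
    (fun j _ s' U V' => abs_wOfRecord_le_one F N θ.ν θ.τ9.M θ.A₁ hζa p _ j s' U V')
    (fun p' g' j s' U V' => wOfRecord_nonneg F N θ.ν θ.τ9.M p' g' j θ.A₁ hζ0 s' U V')
    (fun j _ s' => measurable_chiSeqOfRecord_of_localBg hU θ.τ9.M _ p.K j s') k hk.le).2 s

/-- **THE 𝐓-SLOTS ALONG THE χ-HISTORIES ARE INTEGRABLE AT EVERY POSITIVE LEVEL** under (H-U) ∧ (H-ζ) ∧ the ζ-size law ∧ `0 ≤ ζ`, any selector (`Record13` :605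
in the χ slot). [cite: Balaban1988Convergent, (3.24)–(3.25) p.270; Balaban1989LargeFieldI, (0.3) p.176 (bookkeeping)] -/
theorem Stage13Params.integrable_slotsTOfRecord₁₃_succ_of_localBg_chi (θ : Stage13Params F N) (χ : ChiSlot F N)
    (hU : LocalBgMeasurable F N θ.ν) (hζ : ZetaMeasurable F N θ.ζ) (hζa : IsZetaAbsLeOne F N θ.ν θ.τ9.M θ.ζ)
    (hζ0 : ∀ p g k s Pl Ql RS U V', 0 ≤ θ.ζ p g k s Pl Ql RS U V') (p : B12.RunParams) (k : ℕ) (hk : k < p.K)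
    (s' : SeqOfRecord F θ.ν θ.τ9.M (gOfRecord₁₃Chi F N θ χ p) p.K (k + 1)) :
    Integrable (slotsTOfRecord F N θ.ν θ.τ9 (EOfRecord₁₃Chi F N θ χ) (wOfRecord₉ F N θ.toStage9Params) θ.ppSel p (gOfRecord₁₃Chi F N θ χ p) (k + 1) s')
      (fieldMeasure (F.P p.K) (k + 1) (SU N)) := by
  have hw : ∀ j, j < p.K → ∀ s', Measurable (fun z : GaugeField (F.P p.K) (j + 1) (SU N) × GaugeField (F.P p.K) j (SU N) =>
      wOfRecord₉ F N θ.toStage9Params p (gOfRecord₁₃Chi F N θ χ p) j s' z.2 z.1) :=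
    fun j _ s' => measurable_wOfRecord_of_localBg hU θ.τ9.M θ.A₁ hζ p _ j s'
  have hwb : ∀ j, j < p.K → ∀ s' U V', |wOfRecord₉ F N θ.toStage9Params p (gOfRecord₁₃Chi F N θ χ p) j s' U V'| ≤ 1 :=
    fun j _ s' U V' => abs_wOfRecord_le_one F N θ.ν θ.τ9.M θ.A₁ hζa p _ j s' U V'
  have hw0 : ∀ p' g' j s' U V', 0 ≤ wOfRecord₉ F N θ.toStage9Params p' g' j s' U V' :=
    fun p' g' j s' U V' => wOfRecord_nonneg F N θ.ν θ.τ9.M p' g' j θ.A₁ hζ0 s' U V'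
  have hχ : ∀ j, j ≤ p.K → ∀ s, Measurable (chiSeqOfRecord F N θ.ν θ.τ9.M (gOfRecord₁₃Chi F N θ χ p) p.K j s) :=
    fun j _ s => measurable_chiSeqOfRecord_of_localBg hU θ.τ9.M _ p.K j s
  obtain ⟨-, hpiece⟩ := piece_slotsOfRecord_measurable_integrable F N θ.ν θ.τ9 (EOfRecord₁₃Chi F N θ χ) θ.ppSel hw hwb hw0 hχ k hk.le
  rw [slotsTOfRecord_succ]
  exact integrable_tstepOfRecord F N θ.ν θ.τ9.M hk (hw k hk) (hwb k hk) hpiece s'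

/-- **ROW `rstep` (INTEGRABLE FORM) UNDER (H-U) ∧ (H-ζ) ∧ THE ζ-SIZE LAW ∧ `0 ≤ ζ` AT EVERY SELECTOR THAT MOVES ONLY DEAD SEQUENCES** along the χ-histories
(`Record13` :627 in the χ slot; def-R's `provisosInt_towerRepOfRecord_of_sel_fixed_or_null`).
[cite: Balaban1989LargeFieldI, (0.3)–(0.4) p.176; Balaban1988Convergent, (2.17)–(2.18) p.257, (3.24)–(3.25) p.270 (bookkeeping)] -/
theorem Stage13Params.rstep₁₃_of_localBg_of_sel_chi (θ : Stage13Params F N) (χ : ChiSlot F N)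
    (hU : LocalBgMeasurable F N θ.ν) (hζ : ZetaMeasurable F N θ.ζ) (hζa : IsZetaAbsLeOne F N θ.ν θ.τ9.M θ.ζ)
    (hζ0 : ∀ p g k s Pl Ql RS U V', 0 ≤ θ.ζ p g k s Pl Ql RS U V')
    (hsel : ∀ (p : B12.RunParams) (k : ℕ) [DecidableEq (PBond (F.P p.K) (k + 1))], k < p.K →
      ∀ s, θ.ppSel p (gOfRecord₁₃Chi F N θ χ p) (k + 1) s = s ∨
        ∀ V, slotsTOfRecord F N θ.ν θ.τ9 (EOfRecord₁₃Chi F N θ χ) (wOfRecord₉ F N θ.toStage9Params) θ.ppSel p (gOfRecord₁₃Chi F N θ χ p) (k + 1) s V = 0 ∨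
          B15.BasicStep.fibreIntegral (fibOfSeq F θ.ν θ.τ9 p (gOfRecord₁₃Chi F N θ χ p) (k + 1) s)
            (fun V => chiSeqOfRecord F N θ.ν θ.τ9.M (gOfRecord₁₃Chi F N θ χ p) p.K (k + 1) s V *
              slotsTOfRecord F N θ.ν θ.τ9 (EOfRecord₁₃Chi F N θ χ) (wOfRecord₉ F N θ.toStage9Params) θ.ppSel p (gOfRecord₁₃Chi F N θ χ p) (k + 1) s V) V = 0) :
    ∀ (p : B12.RunParams) (k : ℕ) [DecidableEq (PBond (F.P p.K) (k + 1))], k < p.K →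
      (towerRepOfRecord F N θ.ν θ.τ9 (slotsTOfRecord F N θ.ν θ.τ9 (EOfRecord₁₃Chi F N θ χ) (wOfRecord₉ F N θ.toStage9Params) θ.ppSel)
        θ.ppSel p (gOfRecord₁₃Chi F N θ χ p) (k + 1)).toRepData.ProvisosInt := by
  intro p k _ hk
  exact provisosInt_towerRepOfRecord_of_sel_fixed_or_null F N θ.ν θ.τ9 _ θ.ppSel p _ (k + 1) (hsel p k hk)
    (fun s => (measurable_chiSeqOfRecord_of_localBg hU θ.τ9.M _ p.K (k + 1) s).aestronglyMeasurable)
    (θ.integrable_slotsTOfRecord₁₃_succ_of_localBg_chi χ hU hζ hζa hζ0 p k hk)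
    (fun s => Filter.Eventually.of_forall (slotsTOfRecord_nonneg F N θ.ν θ.τ9 (EOfRecord₁₃Chi F N θ χ)
      (fun p' g' j s' U V' => wOfRecord_nonneg F N θ.ν θ.τ9.M p' g' j θ.A₁ hζ0 s' U V') θ.ppSel p (gOfRecord₁₃Chi F N θ χ p) (k + 1) s))

/-- **ROW `rstep` (INTEGRABLE FORM) AT THE χ-LIVE SELECTOR** under (H-U) ∧ (H-ζ) ∧ the ζ-size law ∧ `0 ≤ ζ` (`Record13` :660 in the χ slot: the live selector
moves only dead sequences, `ppSelLiveOfRecord_fixed_or_dead`). [cite: Balaban1989LargeFieldI, (0.3)–(0.4) p.176; Balaban1988Convergent, (2.17)–(2.18) p.257 (bookkeeping)] -/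
theorem Stage13Params.rstep₁₃_of_localBg_liveSel_chi (θ : Stage13Params F N) (χ : ChiSlot F N)
    (hsel : θ.ppSel = ppSelLiveOfRecord F N θ.ν θ.τ9 (EOfRecord₁₃Chi F N θ χ) (wOfRecord₉ F N θ.toStage9Params))
    (hU : LocalBgMeasurable F N θ.ν) (hζ : ZetaMeasurable F N θ.ζ) (hζa : IsZetaAbsLeOne F N θ.ν θ.τ9.M θ.ζ)
    (hζ0 : ∀ p g k s Pl Ql RS U V', 0 ≤ θ.ζ p g k s Pl Ql RS U V') :
    ∀ (p : B12.RunParams) (k : ℕ) [DecidableEq (PBond (F.P p.K) (k + 1))], k < p.K →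
      (towerRepOfRecord F N θ.ν θ.τ9 (slotsTOfRecord F N θ.ν θ.τ9 (EOfRecord₁₃Chi F N θ χ) (wOfRecord₉ F N θ.toStage9Params) θ.ppSel)
        θ.ppSel p (gOfRecord₁₃Chi F N θ χ p) (k + 1)).toRepData.ProvisosInt :=
  θ.rstep₁₃_of_localBg_of_sel_chi χ hU hζ hζa hζ0 fun p k _ _ s => by
    rw [hsel]
    exact ppSelLiveOfRecord_fixed_or_dead θ.ν θ.τ9 (EOfRecord₁₃Chi F N θ χ) (wOfRecord₉ F N θ.toStage9Params) p (gOfRecord₁₃Chi F N θ χ p) k s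

end Rows4cChi

/-! ## §1. THE ₁₃ LIVE RE-PIN IN THE χ SLOT and its faces, transports, row P12, row-P11 objects and provisos (`Record13LiveSelector` §1 token for token) -/

section Repin13Chi

variable (F : T4Family) (N : ℕ) [NeZero N]

/-- **THE LIVE RE-PIN, STAGE 13, IN THE χ SLOT** of `θ : Stage13Params` at the β-slot `χ`: the same parameter with its `p–p′` selector replaced by the live selector
of record at `θ`'s own numerics, the χ-generic ₁₃ normalisations `EOfRecord₁₃Chi θ χ` and the step weights `wOfRecord₉` (selector-blind) — node00-def-K0a's
`Stage13Params.liveRepin₁₃` (:39) with the ONE centred token `EOfRecord₁₃ ↦ EOfRecord₁₃Chi … χ`; at `χ := chiβOfRecord₁₃ θ` it IS `θ.liveRepin₁₃` (`liveRepin₁₃Chi_chiβ`, `rfl`).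
[cite: Balaban1989LargeFieldI, (0.3) p.176 and p.177; Balaban1988Convergent, (3.22) p.269; Balaban1987RG1, (2.9) p.266] -/
def Stage13Params.liveRepin₁₃Chi (θ : Stage13Params F N) (χ : ChiSlot F N) : Stage13Params F N :=
  { θ with ppSel := ppSelLiveOfRecord F N θ.ν θ.τ9 (EOfRecord₁₃Chi F N θ χ) (wOfRecord₉ F N θ.toStage9Params) }

variable (θ : Stage13Params F N) (χ : ChiSlot F N)

/-- The χ re-pin keeps the Stage-8 part (`rfl`). [cite: Balaban1987RG1, (0.21) p.256 (bookkeeping)] -/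
theorem Stage13Params.liveRepin₁₃Chi_toStage8Params : (θ.liveRepin₁₃Chi F N χ).toStage8Params = θ.toStage8Params := rfl

/-- The χ re-pin keeps the Stage-12 part's numerics `ν` (`rfl`). [cite: Balaban1987RG1, (0.21) p.256 (bookkeeping)] -/
theorem Stage13Params.liveRepin₁₃Chi_ν : (θ.liveRepin₁₃Chi F N χ).ν = θ.ν := rfl

/-- The χ re-pin keeps the window `γ` (`rfl`). [cite: Balaban1987RG1, Thm 1 p.259 (bookkeeping)] -/
theorem Stage13Params.liveRepin₁₃Chi_γ : (θ.liveRepin₁₃Chi F N χ).γ = θ.γ := rfl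

/-- The χ re-pin keeps the (2.9) threshold `ε₂₉` (`rfl`). [cite: Balaban1987RG1, (2.9) p.266 (bookkeeping)] -/
theorem Stage13Params.liveRepin₁₃Chi_ε₂₉ : (θ.liveRepin₁₃Chi F N χ).ε₂₉ = θ.ε₂₉ := rfl

/-- The χ re-pin's selector IS the live selector of record along the χ-generic ₁₃ plugs (`rfl`). [cite: Balaban1989LargeFieldI, (0.3) p.176 (bookkeeping)] -/
theorem Stage13Params.liveRepin₁₃Chi_ppSel :
    (θ.liveRepin₁₃Chi F N χ).ppSel = ppSelLiveOfRecord F N θ.ν θ.τ9 (EOfRecord₁₃Chi F N θ χ) (wOfRecord₉ F N θ.toStage9Params) := rfl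

/-- The χ re-pin keeps `ζ` (`rfl`). [cite: Balaban1988Convergent, (3.16) p.268 (bookkeeping)] -/
theorem Stage13Params.liveRepin₁₃Chi_ζ : (θ.liveRepin₁₃Chi F N χ).ζ = θ.ζ := rfl

/-- The χ re-pin keeps `Rz` (`rfl`). [cite: Balaban1988Convergent, (2.21) p.258 (bookkeeping)] -/
theorem Stage13Params.liveRepin₁₃Chi_Rz : (θ.liveRepin₁₃Chi F N χ).Rz = θ.Rz := rfl

/-- The χ re-pin keeps `Zt` (`rfl`). [cite: Balaban1988Convergent, (3.20) p.269 (bookkeeping)] -/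
theorem Stage13Params.liveRepin₁₃Chi_Zt : (θ.liveRepin₁₃Chi F N χ).Zt = θ.Zt := rfl

/-- The χ re-pin keeps `A₁` (`rfl`). [cite: Balaban1987RG1, (1.16) p.262 (bookkeeping)] -/
theorem Stage13Params.liveRepin₁₃Chi_A₁ : (θ.liveRepin₁₃Chi F N χ).A₁ = θ.A₁ := rfl

/-- The χ-generic ₁₃ histories are selector-blind: the χ re-pin keeps them (`rfl`). [cite: Balaban1987RG1, (0.17)–(0.20) pp.255–256 (bookkeeping)] -/
theorem Stage13Params.gOfRecord₁₃Chi_liveRepin₁₃Chi :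
    gOfRecord₁₃Chi F N (θ.liveRepin₁₃Chi F N χ) χ = gOfRecord₁₃Chi F N θ χ := rfl

/-- The χ-generic ₁₃ normalisations are selector-blind (`rfl`). [cite: Balaban1988Convergent, (1.15) p.249 (bookkeeping)] -/
theorem Stage13Params.EOfRecord₁₃Chi_liveRepin₁₃Chi :
    EOfRecord₁₃Chi F N (θ.liveRepin₁₃Chi F N χ) χ = EOfRecord₁₃Chi F N θ χ := rfl

/-- The χ-generic β is selector-blind (`rfl`). [cite: Balaban1987RG1, (1.20)–(1.22) p.264 (bookkeeping)] -/
theorem Stage13Params.betaOfRecord₁₃Chi_liveRepin₁₃Chi :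
    betaOfRecord₁₃Chi F N (θ.liveRepin₁₃Chi F N χ) χ = betaOfRecord₁₃Chi F N θ χ := rfl

/-- The step weights are selector-blind (`rfl`). [cite: Balaban1988Convergent, (3.2)–(3.9) pp.265–266 (bookkeeping)] -/
theorem Stage13Params.wOfRecord₉_liveRepin₁₃Chi :
    wOfRecord₉ F N (θ.liveRepin₁₃Chi F N χ).toStage9Params = wOfRecord₉ F N θ.toStage9Params := rfl

/-- The record's own β-slot is selector-blind: the χ re-pin keeps `chiβOfRecord₁₃` (`rfl`). [cite: Balaban1987RG1, (2.9) p.266 (bookkeeping)] -/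
theorem Stage13Params.chiβOfRecord₁₃_liveRepin₁₃Chi : chiβOfRecord₁₃ F N (θ.liveRepin₁₃Chi F N χ) = chiβOfRecord₁₃ F N θ := rfl

/-- … and the re-centred β-slot `chiβOfRecord₁₃Ax` (`rfl`). [cite: Balaban1987RG1, (2.9) p.266, p.265 (2.3) (bookkeeping)] -/
theorem Stage13Params.chiβOfRecord₁₃Ax_liveRepin₁₃Chi : chiβOfRecord₁₃Ax F N (θ.liveRepin₁₃Chi F N χ) = chiβOfRecord₁₃Ax F N θ := rfl

variable {F N θ χ}

/-- `Admissible` is selector-blind: it transports to the χ re-pin. [cite: Balaban1987RG1, (0.21) p.256 (bookkeeping)] -/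
theorem Stage13Params.Admissible.liveRepin₁₃Chi (h : θ.Admissible F N) : (θ.liveRepin₁₃Chi F N χ).Admissible F N := h

/-- `ZtUnity` is selector-blind. [cite: Balaban1988Convergent, (3.16)–(3.20) pp.268–269 (bookkeeping)] -/
theorem Stage13Params.ZtUnity.liveRepin₁₃Chi (h : θ.ZtUnity F N) : (θ.liveRepin₁₃Chi F N χ).ZtUnity F N := h

/-- K0b's `HasResidualsOfRecord` is selector-blind. [cite: Balaban1988Convergent, (3.16) p.268, (2.21) p.258, (3.20) p.269 (bookkeeping)] -/
theorem Stage13Params.HasResidualsOfRecord.liveRepin₁₃Chi (h : θ.HasResidualsOfRecord F N) : (θ.liveRepin₁₃Chi F N χ).HasResidualsOfRecord F N :=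
  ⟨h.zeta_eq, h.Rz_eq, h.Zt_eq⟩

variable (F N θ χ)

/-- **`SlotsNondegenerate₁₃Chi` AT THE χ LIVE RE-PIN ⟺ PER-LEVEL LIVENESS UP TO THE TORUS** along the χ-histories (`slotsNondegenerate₁₃_liveRepin_iff` in the χ slot).
[cite: Balaban1988Convergent, (3.22)–(3.24) pp.269–270; Balaban1989LargeFieldI, (0.3) p.176] -/
theorem Stage13Params.slotsNondegenerate₁₃_liveRepin_iff_chi :
    (θ.liveRepin₁₃Chi F N χ).SlotsNondegenerate₁₃Chi F N χ ↔
      ∀ (p : B12.RunParams) (k : ℕ), k + 1 ≤ p.K → Nonempty (SeqOfRecord F θ.ν θ.τ9.M (gOfRecord₁₃Chi F N θ χ p) p.K (k + 1)) →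
        ∃ s, LiveSeq F N θ.ν θ.τ9 p (gOfRecord₁₃Chi F N θ χ p) (k + 1)
          (slotsTOfRecord F N θ.ν θ.τ9 (EOfRecord₁₃Chi F N θ χ) (wOfRecord₉ F N θ.toStage9Params) (θ.liveRepin₁₃Chi F N χ).ppSel p
            (gOfRecord₁₃Chi F N θ χ p) (k + 1)) s := by
  constructor
  · intro h p k hk
    refine (slotsOfRecord_ppSelLive_succ_nondegenerate_iff F N θ.ν θ.τ9 _ _ p _ k).mp (fun s hs => ?_)
    have h' := h p (k + 1)
    apply h' <;> first | exact hk | exact hs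
  · intro h p k s
    intros
    cases k with
    | zero => exact slotsOfRecord_zero_ne_zero F N θ.ν θ.τ9 _ _ _ p _ s
    | succ k =>
      refine (slotsOfRecord_ppSelLive_succ_nondegenerate_iff F N θ.ν θ.τ9 _ _ p _ k).mpr (h p k ‹_›) s ?_
      assumption

/-- **★ `SlotsNondegenerate₁₃Chi` AT THE χ LIVE RE-PIN, INT currency** (`slotsNondegenerate₁₃_liveRepin_of_int` in the χ slot: the history-generic
`slotsOfRecord_ppSelLive_ne_zero_of_le_of_int` at `(EOfRecord₁₃Chi θ χ, wOfRecord₉ θ, gOfRecord₁₃Chi θ χ p)`).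
[cite: Balaban1988Convergent, (3.22) p.269, (3.24) p.270; Balaban1989LargeFieldI, (0.3)–(0.4) p.176] -/
theorem Stage13Params.slotsNondegenerate₁₃_liveRepin_of_int_chi
    (hT : ∀ (p : B12.RunParams) (j : ℕ), j < p.K →
      TStepProvisos F N θ.ν θ.τ9 (EOfRecord₁₃Chi F N θ χ) (wOfRecord₉ F N θ.toStage9Params) (θ.liveRepin₁₃Chi F N χ).ppSel p
        (gOfRecord₁₃Chi F N θ χ p) j)
    (hR : ∀ (p : B12.RunParams) (j : ℕ) [DecidableEq (PBond (F.P p.K) (j + 1))], j < p.K →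
      (towerRepOfRecord F N θ.ν θ.τ9
        (slotsTOfRecord F N θ.ν θ.τ9 (EOfRecord₁₃Chi F N θ χ) (wOfRecord₉ F N θ.toStage9Params) (θ.liveRepin₁₃Chi F N χ).ppSel)
        (θ.liveRepin₁₃Chi F N χ).ppSel p (gOfRecord₁₃Chi F N θ χ p) (j + 1)).toRepData.ProvisosInt) :
    (θ.liveRepin₁₃Chi F N χ).SlotsNondegenerate₁₃Chi F N χ :=
  fun p k s hk hs => slotsOfRecord_ppSelLive_ne_zero_of_le_of_int F N θ.ν θ.τ9 _ _ p _ (hT p) (fun j _ hj => hR p j hj) k hk s hs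

/-- **★ `SlotsNondegenerate₁₃Chi` AT THE χ LIVE RE-PIN from `Provisos₁₃Chi` there ALONE** (its `tstep` and `rstep` fields feed the Int instance).
[cite: Balaban1988Convergent, (3.22) p.269, (3.24) p.270; Balaban1989LargeFieldI, (0.3)–(0.4) p.176] -/
theorem Stage13Params.slotsNondegenerate₁₃_liveRepin_chi (h : (θ.liveRepin₁₃Chi F N χ).Provisos₁₃Chi F N χ) :
    (θ.liveRepin₁₃Chi F N χ).SlotsNondegenerate₁₃Chi F N χ :=
  Stage13Params.slotsNondegenerate₁₃_liveRepin_of_int_chi F N θ χ (fun p j hj => h.tstep p j hj) (fun p j _ hj => h.rstep p j hj)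

/-- The row-P11 run objects are selector-blind: the χ-generic §2 setting at the χ re-pin IS `θ`'s (`rfl`). [cite: Balaban1988Convergent, (2.28) p.259 (bookkeeping)] -/
theorem Stage13Params.settingOfRecord₁₃Chi_liveRepin₁₃Chi (p : B12.RunParams) :
    settingOfRecord₁₃Chi F N (θ.liveRepin₁₃Chi F N χ) χ p = settingOfRecord₁₃Chi F N θ χ p := rfl

/-- … the χ-generic support of record at the χ re-pin IS `θ`'s (`rfl`). [cite: Balaban1988Convergent, (2.10) p.256 (bookkeeping)] -/
theorem Stage13Params.suppOfRecord₁₃Chi_liveRepin₁₃Chi (p : B12.RunParams) (n : ℕ) :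
    suppOfRecord₁₃Chi F N (θ.liveRepin₁₃Chi F N χ) χ p n = suppOfRecord₁₃Chi F N θ χ p n := rfl

/-- … and the χ-generic background maps of record at the χ re-pin ARE `θ`'s (by cases on the length). [cite: Balaban1988Convergent, (2.12)–(2.13) pp.256–257 (bookkeeping)] -/
theorem Stage13Params.UbgOfRecord₁₃Chi_liveRepin₁₃Chi (p : B12.RunParams) (n : ℕ) :
    UbgOfRecord₁₃Chi F N (θ.liveRepin₁₃Chi F N χ) χ p n = UbgOfRecord₁₃Chi F N θ χ p n := by
  cases n <;> rfl

/-- **ROW P11 IS SELECTOR-BLIND in the χ slot**: the `bg` text at the χ re-pin ⟺ the `bg` text at `θ` (same window, χ-histories, residual, support, background maps).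
[cite: Balaban1988Convergent, (2.28) p.259 (bookkeeping)] -/
theorem Stage13Params.bg_liveRepin₁₃_iff_chi :
    (∀ (p : B12.RunParams) (n : ℕ), n ≤ p.K → Step.InInterval θ.γ n (gOfRecord₁₃Chi F N θ χ p) →
      BgProvisoΛ F N p.K (settingOfRecord₁₃Chi F N (θ.liveRepin₁₃Chi F N χ) χ p) (θ.Rz p.K) θ.τ9.M n
        (suppOfRecord₁₃Chi F N (θ.liveRepin₁₃Chi F N χ) χ p n) (UbgOfRecord₁₃Chi F N (θ.liveRepin₁₃Chi F N χ) χ p n)) ↔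
    (∀ (p : B12.RunParams) (n : ℕ), n ≤ p.K → Step.InInterval θ.γ n (gOfRecord₁₃Chi F N θ χ p) →
      BgProvisoΛ F N p.K (settingOfRecord₁₃Chi F N θ χ p) (θ.Rz p.K) θ.τ9.M n (suppOfRecord₁₃Chi F N θ χ p n) (UbgOfRecord₁₃Chi F N θ χ p n)) := by
  refine forall_congr' fun p => forall_congr' fun n => ?_
  rw [θ.UbgOfRecord₁₃Chi_liveRepin₁₃Chi F N χ p n]
  rfl

variable {F N θ χ} in
/-- **★ `Provisos₁₃Chi` AT THE χ LIVE RE-PIN OF A PARAMETER CARRYING K0b's RESIDUALS, FROM (H-U) AND ROW P11 ALONE** (`provisos₁₃_liveRepin₁₃_of_localBg` in the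
χ slot): rows `intPiece` ∕ `measω` ∕ `measChi` ∕ `rstep` are §0's theorems of (H-U) `LocalBgMeasurable θ.ν` and the ζ-laws of K0b's (3.16) factor; `zetaUnity`,
`rzLaws`, `ztLaws`, `ztLocal`, `zetaMeas` are K0b's ∕ (H-ζ); `bg` is DISPLAYED.  A REDUCTION — nothing of Bałaban is asserted.
[cite: Balaban1988Convergent, (2.18) p.257, (2.28) p.259, (3.2)–(3.9) pp.265–266, (3.16) p.268, (3.20)–(3.22) p.269; Balaban1989LargeFieldI, (0.3)–(0.4) p.176 (bookkeeping)] -/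
theorem Stage13Params.provisos₁₃_liveRepin₁₃_of_localBg_chi (hU : LocalBgMeasurable F N θ.ν) (hres : θ.HasResidualsOfRecord F N)
    (hbg : ∀ (p : B12.RunParams) (n : ℕ), n ≤ p.K → Step.InInterval θ.γ n (gOfRecord₁₃Chi F N θ χ p) →
      BgProvisoΛ F N p.K (settingOfRecord₁₃Chi F N (θ.liveRepin₁₃Chi F N χ) χ p) (θ.Rz p.K) θ.τ9.M n
        (suppOfRecord₁₃Chi F N (θ.liveRepin₁₃Chi F N χ) χ p n) (UbgOfRecord₁₃Chi F N (θ.liveRepin₁₃Chi F N χ) χ p n)) :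
    (θ.liveRepin₁₃Chi F N χ).Provisos₁₃Chi F N χ :=
  have hζ : ZetaMeasurable F N θ.ζ := by
    rw [hres.zeta_eq]; exact zetaMeasurable_zeta316OfRecord_of_localBg hU θ.τ9.M θ.A₁
  have hζ0 : ∀ p g k s Pl Ql RS U V', 0 ≤ θ.ζ p g k s Pl Ql RS U V' := by
    rw [hres.zeta_eq]; exact fun p g k s Pl Ql RS U V' => zeta316OfRecord_nonneg θ.A₁ p g k s Pl Ql RS U V'
  { intPiece := (θ.liveRepin₁₃Chi F N χ).intPiece₁₃_of_localBg_chi χ hU hζ hres.zetaAbs hζ0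
    measω := (θ.liveRepin₁₃Chi F N χ).measω₁₃_of_localBg_chi χ hU hζ
    measChi := (θ.liveRepin₁₃Chi F N χ).measChi₁₃_of_localBg_chi χ hU
    zetaUnity := hres.zetaUnity
    zetaAbs := hres.zetaAbs
    rstep := (θ.liveRepin₁₃Chi F N χ).rstep₁₃_of_localBg_liveSel_chi χ rfl hU hζ hres.zetaAbs hζ0
    rzLaws := hres.rzLaws
    ztLaws := hres.ztLaws
    ztLocal := hres.ztLocal
    bg := hbg
    zetaMeas := hζ }

variable {F N θ χ} in
/-- **★★ `Provisos₁₃Chi` AT THE χ LIVE RE-PIN OF A PARAMETER CARRYING K0b's RESIDUALS, FROM ROW P11 ALONE** — (H-U) is seat K0c's THEOREM `localBgMeasurable`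
(`Node00/Record12MeasurabilityAbsolute`).  `bg` DISPLAYED. [cite: Balaban1988Convergent, (2.12) p.256, (2.18) p.257, (2.28) p.259, (3.16) p.268, (3.22) p.269; Balaban1989LargeFieldI, (0.3)–(0.4) p.176 (bookkeeping)] -/
theorem Stage13Params.provisos₁₃_liveRepin₁₃_of_bg_chi (hres : θ.HasResidualsOfRecord F N)
    (hbg : ∀ (p : B12.RunParams) (n : ℕ), n ≤ p.K → Step.InInterval θ.γ n (gOfRecord₁₃Chi F N θ χ p) →
      BgProvisoΛ F N p.K (settingOfRecord₁₃Chi F N (θ.liveRepin₁₃Chi F N χ) χ p) (θ.Rz p.K) θ.τ9.M n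
        (suppOfRecord₁₃Chi F N (θ.liveRepin₁₃Chi F N χ) χ p n) (UbgOfRecord₁₃Chi F N (θ.liveRepin₁₃Chi F N χ) χ p n)) :
    (θ.liveRepin₁₃Chi F N χ).Provisos₁₃Chi F N χ :=
  θ.provisos₁₃_liveRepin₁₃_of_localBg_chi (localBgMeasurable F N θ.ν) hres hbg

end Repin13Chi

/-! ## §2. FILE 8b's ROW P12 AT THE χ LIVE RE-PIN — HYPOTHESIS-FREE UP TO K0b's RESIDUALS (`Record13LiveSelectorFamily` :335 ∕ :352 in the χ slot) -/

section RowP12FreeChi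

variable {F : T4Family} {N : ℕ} [NeZero N] {θ : Stage13Params F N} {χ : ChiSlot F N}

/-- **★ ROW P12 (`SlotsNondegenerate₁₃Chi`) AT THE χ LIVE RE-PIN OF A PARAMETER CARRYING K0b's RESIDUALS FROM (H-U) ALONE** — §1's Int instance with BOTH inputs
supplied by §0's rows (`intPiece₁₃_of_localBg_chi` at the χ live selector, `measω₁₃_∕measChi₁₃_of_localBg_chi`, `abs_wOfRecord_le_one`, `isStepUnity_wOfRecord`) and the
Int-form R-step provisos by `rstep₁₃_of_localBg_liveSel_chi` (`hsel` is `rfl` at the χ re-pin).  NO field of `Provisos₁₃Chi` is read.  A REDUCTION.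
[cite: Balaban1988Convergent, (2.18) p.257, (3.2)–(3.9) pp.265–266, (3.16) p.268, (3.22) p.269, (3.24)–(3.25) p.270; Balaban1989LargeFieldI, (0.3)–(0.4) p.176 and p.177 (bookkeeping)] -/
theorem Stage13Params.slotsNondegenerate₁₃_liveRepin_of_localBg_chi (hU : LocalBgMeasurable F N θ.ν) (hres : θ.HasResidualsOfRecord F N) :
    (θ.liveRepin₁₃Chi F N χ).SlotsNondegenerate₁₃Chi F N χ :=
  have hζ : ZetaMeasurable F N θ.ζ := by
    rw [hres.zeta_eq]; exact zetaMeasurable_zeta316OfRecord_of_localBg hU θ.τ9.M θ.A₁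
  have hζ0 : ∀ p g k s Pl Ql RS U V', 0 ≤ θ.ζ p g k s Pl Ql RS U V' := by
    rw [hres.zeta_eq]; exact fun p g k s Pl Ql RS U V' => zeta316OfRecord_nonneg θ.A₁ p g k s Pl Ql RS U V'
  Stage13Params.slotsNondegenerate₁₃_liveRepin_of_int_chi F N θ χ
    (fun p k hk =>
      { intPiece := (θ.liveRepin₁₃Chi F N χ).intPiece₁₃_of_localBg_chi χ hU hζ hres.zetaAbs hζ0 p k hk
        measW := fun s' => measurable_wOfRecord F N θ.ν θ.τ9.M θ.A₁ θ.ζ p (gOfRecord₁₃Chi F N θ χ p) k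
          (θ.measω₁₃_of_localBg_chi χ hU hζ p k hk) s'
        absW_le := fun s' U V' => abs_wOfRecord_le_one F N θ.ν θ.τ9.M θ.A₁ hres.zetaAbs p (gOfRecord₁₃Chi F N θ χ p) k s' U V'
        measChi := θ.measChi₁₃_of_localBg_chi χ hU p k hk
        unity := isStepUnity_wOfRecord F N θ.ν θ.τ9.M θ.A₁ hres.zetaUnity p (gOfRecord₁₃Chi F N θ χ p) k })
    (fun p j _ hj => (θ.liveRepin₁₃Chi F N χ).rstep₁₃_of_localBg_liveSel_chi χ rfl hU hζ hres.zetaAbs hζ0 p j hj)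

/-- **★★ ROW P12 AT THE χ LIVE RE-PIN OF A PARAMETER CARRYING K0b's RESIDUALS — OUTRIGHT** ((H-U) is seat K0c's theorem `localBgMeasurable`).  No proviso is
read. [cite: Balaban1988Convergent, (3.22) p.269, (3.24)–(3.25) p.270; Balaban1989LargeFieldI, (0.3)–(0.4) p.176 (bookkeeping)] -/
theorem Stage13Params.slotsNondegenerate₁₃_liveRepin_of_hasResiduals_chi (hres : θ.HasResidualsOfRecord F N) :
    (θ.liveRepin₁₃Chi F N χ).SlotsNondegenerate₁₃Chi F N χ :=
  Stage13Params.slotsNondegenerate₁₃_liveRepin_of_localBg_chi (localBgMeasurable F N θ.ν) hres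

end RowP12FreeChi

/-! ## §R. RECEIPTS AT THE RECORD'S OWN SLOT `χ := chiβOfRecord₁₃ θ`: the χ objects ARE node00-def-K0a's (`rfl` ∕ `Iff.rfl`; nothing of record re-keyed) -/

section Receipts

variable {F : T4Family} {N : ℕ} [NeZero N] (θ : Stage13Params F N)

/-- `liveRepin₁₃Chi θ (chiβOfRecord₁₃ θ) = liveRepin₁₃ θ` (`rfl`). [cite: Balaban1989LargeFieldI, (0.3) p.176 (bookkeeping)] -/
theorem Stage13Params.liveRepin₁₃Chi_chiβ : θ.liveRepin₁₃Chi F N (chiβOfRecord₁₃ F N θ) = θ.liveRepin₁₃ F N := rfl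

/-- Row P12 in the χ slot at the record's own slot IS row P12 of record at the re-pin (`Iff.rfl`). [cite: Balaban1988Convergent, (3.22) p.269 (bookkeeping)] -/
theorem Stage13Params.slotsNondegenerate₁₃Chi_liveRepin₁₃Chi_chiβ_iff :
    (θ.liveRepin₁₃Chi F N (chiβOfRecord₁₃ F N θ)).SlotsNondegenerate₁₃Chi F N (chiβOfRecord₁₃ F N θ) ↔
      (θ.liveRepin₁₃ F N).SlotsNondegenerate₁₃ F N := Iff.rfl

/-- `Provisos₁₃Chi` in the χ slot at the record's own slot ⟺ `Provisos₁₃` of record at the re-pin ([Ax-3b]'s `provisos₁₃Chi_chiβ_iff` at the re-pin).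
[cite: Balaban1988Convergent, (2.18) p.257, (2.28) p.259 (bookkeeping)] -/
theorem Stage13Params.provisos₁₃Chi_liveRepin₁₃Chi_chiβ_iff :
    (θ.liveRepin₁₃Chi F N (chiβOfRecord₁₃ F N θ)).Provisos₁₃Chi F N (chiβOfRecord₁₃ F N θ) ↔ (θ.liveRepin₁₃ F N).Provisos₁₃ F N :=
  provisos₁₃Chi_chiβ_iff (θ.liveRepin₁₃ F N)

end Receipts

/-! ## §A. THE RE-CENTRED EDITION `χ := chiβOfRecord₁₃Ax θ` ([Ax-3]'s block-axial β-slot) -/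

section Ax

variable (F : T4Family) (N : ℕ) [NeZero N]

/-- **THE ₁₃ LIVE RE-PIN, RE-CENTRED**: `θ.liveRepin₁₃Chi (chiβOfRecord₁₃Ax θ)` — the live selector of record pinned along the ₁₃ plugs read through the
block-axial (2.9) species. [cite: Balaban1989LargeFieldI, (0.3) p.176; Balaban1987RG1, (2.9) p.266, p.265 (2.3)] -/
abbrev Stage13Params.liveRepin₁₃Ax (θ : Stage13Params F N) : Stage13Params F N :=
  θ.liveRepin₁₃Chi F N (chiβOfRecord₁₃Ax F N θ)

variable {F N} (θ : Stage13Params F N)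

/-- The re-centred re-pin keeps the re-centred β-slot (`rfl`): its own `…Ax` objects are the χ objects at `chiβOfRecord₁₃Ax θ`. [cite: Balaban1987RG1, (2.9) p.266 (bookkeeping)] -/
theorem Stage13Params.chiβOfRecord₁₃Ax_liveRepin₁₃Ax : chiβOfRecord₁₃Ax F N (θ.liveRepin₁₃Ax F N) = chiβOfRecord₁₃Ax F N θ := rfl

/-- `SlotsNondegenerate₁₃Ax` at the re-centred re-pin IS §1's χ row at `chiβOfRecord₁₃Ax θ` (`Iff.rfl`). [cite: Balaban1988Convergent, (3.22) p.269 (bookkeeping)] -/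
theorem Stage13Params.slotsNondegenerate₁₃Ax_liveRepin₁₃Ax_iff :
    (θ.liveRepin₁₃Ax F N).SlotsNondegenerate₁₃Ax F N ↔
      (θ.liveRepin₁₃Chi F N (chiβOfRecord₁₃Ax F N θ)).SlotsNondegenerate₁₃Chi F N (chiβOfRecord₁₃Ax F N θ) := Iff.rfl

/-- `Provisos₁₃Ax` at the re-centred re-pin IS §1's χ proviso at `chiβOfRecord₁₃Ax θ` (`Iff.rfl`). [cite: Balaban1988Convergent, (2.18) p.257 (bookkeeping)] -/
theorem Stage13Params.provisos₁₃Ax_liveRepin₁₃Ax_iff :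
    (θ.liveRepin₁₃Ax F N).Provisos₁₃Ax F N ↔ (θ.liveRepin₁₃Chi F N (chiβOfRecord₁₃Ax F N θ)).Provisos₁₃Chi F N (chiβOfRecord₁₃Ax F N θ) := Iff.rfl

/-- **★★ ROW P12 AT THE RE-CENTRED RE-PIN OF A PARAMETER CARRYING K0b's RESIDUALS — OUTRIGHT.** [cite: Balaban1988Convergent, (3.22) p.269, (3.24)–(3.25) p.270; Balaban1989LargeFieldI, (0.3)–(0.4) p.176 (bookkeeping)] -/
theorem Stage13Params.slotsNondegenerate₁₃Ax_liveRepin₁₃Ax_of_hasResiduals (hres : θ.HasResidualsOfRecord F N) :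
    (θ.liveRepin₁₃Ax F N).SlotsNondegenerate₁₃Ax F N :=
  Stage13Params.slotsNondegenerate₁₃_liveRepin_of_hasResiduals_chi hres

end Ax

end Literature.MathematicalPhysics.QuantumFieldTheory.Balaban1983to89.Node00

end
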